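import Literature.AlgebraicGeometry.Smoothening.JacobianCriterion
import Mathlib.AlgebraicGeometry.Morphisms.Smooth
import Mathlib.RingTheory.RingHom.Smooth
import Mathlib.RingTheory.RingHom.StandardSmooth
import HarnessLib

/-!
# The Jacobian criterion, global form: full rank at every closed point ⟹ smooth

Topic: `Literature/AlgebraicGeometry/Smoothening`. The tree's `Smoothening/JacobianCriterion`
proves the LOCAL Jacobian criterion: for `D = R[T₁, …, Tₙ]/(f₁, …, f_c)` and an injective choice
`a` of `c` columns, the localisation `D[1/Δ_a]` at the maximal minor
`Δ_a = det (∂f_j/∂T_{a i})` is standard smooth over `R` of relative dimension `n - c`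
(`isStandardSmoothOfRelativeDimension_away`, `smooth_away`). This file assembles the GLOBAL
statement used at the end of every explicit resolution / chart computation — e.g. Hu's
*Universal characteristic-free resolution I* (arXiv:2507.21400), Thm. 8.5 ⟹ Thm. 8.6: "the
Jacobian of the defining equations of the chart has full rank at every closed point, hence the
transform is smooth" — namely Görtz–Wedhorn I, Def. 6.14 / Thm. 6.28 read globally, or
Bosch–Lütkebohmert–Raynaud 2.2/7: **if at every maximal ideal of `D` some maximal minor `Δ_a` of
the Jacobian is non-zero (equivalently: the `Δ_a` generate the unit ideal of `D`), then `D` is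
smooth over `R`, `Spec D → Spec R` is `AlgebraicGeometry.Smooth`, indeed
`SmoothOfRelativeDimension (n - c)`.** The proof is the cover of `Spec D` by the basic opens
`D(Δ_a)` (Mathlib: `RingHom.Smooth.ofLocalizationSpanTarget`, `RingHom.Locally`,
`HasRingHomProperty.Spec_iff`) on top of the local criterion.

## Content (all PROVED; no definitions, no named facts — D-0026)

* `span_jacobianMinors_eq_top_of_forall_isMaximal` — the pointwise rank condition at maximal
  ideals gives `Ideal.span {Δ_a} = ⊤`; `forall_isPrime_of_span_jacobianMinors_eq_top` — and
  conversely the span condition gives the rank condition at every PRIME.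
* `smooth_of_span_jacobianMinors_eq_top`, `smooth_of_forall_isMaximal` — `Algebra.Smooth R D`.
* `locally_isStandardSmoothOfRelativeDimension_of_forall_isMaximal` — `R → D` is locally
  standard smooth of relative dimension `n - c`.
* `smooth_specMap_of_forall_isMaximal`, `smoothOfRelativeDimension_specMap_of_forall_isMaximal`
  — the scheme-level conclusions for `Spec D → Spec R`.
* `smooth_of_forall_isMaximal_det` — the same with the minors written as determinants
  `det (∂f_j/∂T_{a i})` in `R[T]` (the form in which a chart computation delivers them).

## References

* U. Görtz, T. Wedhorn, *Algebraic Geometry I: Schemes*, 2nd ed. (2020), Def. 6.14 (p. 159).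
  [GortzWedhorn2020]
* The Stacks project, Tag 00T6 (standard smooth algebras), Tag 00TA (smoothness is local).
  [StacksProject]
* S. Bosch, W. Lütkebohmert, M. Raynaud, *Néron Models* (1990), Prop. 2.2/7. [BLRNeronModels1990]
* Y. Hu, *Universal Characteristic-free Resolution of Singularities, I*, arXiv:2507.21400 (2025),
  Thm. 8.5–8.6 (pp. 67–71) — the intended consumer. [Hu2025]
-/

noncomputable section

open MvPolynomial AlgebraicGeometry

namespace Literature.AlgebraicGeometry.Smoothening

universe u

variable {R : Type u} [CommRing R] {n c : ℕ} (f : Fin c → MvPolynomial (Fin n) R)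

/-- **Rank condition at closed points ⟹ the maximal minors generate the unit ideal.** If every
maximal ideal of `D = R[T]/(f)` misses some maximal Jacobian minor `Δ_a`, then the `Δ_a` span
`⊤`. [folklore] -/
theorem span_jacobianMinors_eq_top_of_forall_isMaximal
    (h : ∀ 𝔪 : Ideal (Quot f), 𝔪.IsMaximal →
      ∃ (a : Fin c → Fin n) (ha : Function.Injective a), jacobianMinor f a ha ∉ 𝔪) :
    Ideal.span {x : Quot f | ∃ (a : Fin c → Fin n) (ha : Function.Injective a),
      jacobianMinor f a ha = x} = ⊤ := by
  by_contra hne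
  obtain ⟨𝔪, h𝔪, hle⟩ := Ideal.exists_le_maximal _ hne
  obtain ⟨a, ha, hnot⟩ := h 𝔪 h𝔪
  exact hnot (hle (Ideal.subset_span ⟨a, ha, rfl⟩))

/-- Conversely, if the maximal minors span `⊤` then every PRIME ideal of `D` misses one of them
(the rank condition at every point of `Spec D`). [folklore] -/
theorem forall_isPrime_of_span_jacobianMinors_eq_top
    (h : Ideal.span {x : Quot f | ∃ (a : Fin c → Fin n) (ha : Function.Injective a),
      jacobianMinor f a ha = x} = ⊤)
    (𝔭 : Ideal (Quot f)) [𝔭.IsPrime] :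
    ∃ (a : Fin c → Fin n) (ha : Function.Injective a), jacobianMinor f a ha ∉ 𝔭 := by
  by_contra hall
  push Not at hall
  have hle : Ideal.span {x : Quot f | ∃ (a : Fin c → Fin n) (ha : Function.Injective a),
      jacobianMinor f a ha = x} ≤ 𝔭 := by
    rw [Ideal.span_le]
    rintro x ⟨a, ha, rfl⟩
    exact hall a ha
  rw [h, top_le_iff] at hle
  exact Ideal.IsPrime.ne_top' hle

/-- **Global Jacobian criterion, span form** (GW I Def. 6.14 / BLR 2.2/7, globalised by the cover
`Spec D = ⋃ D(Δ_a)`): if the maximal Jacobian minors of `f` generate the unit ideal of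
`D = R[T₁, …, Tₙ]/(f₁, …, f_c)`, then `D` is smooth over `R`.
[cite: GortzWedhorn2020, Def. 6.14 (p. 159)] [cite: StacksProject, Tag 00T6] -/
theorem smooth_of_span_jacobianMinors_eq_top
    (h : Ideal.span {x : Quot f | ∃ (a : Fin c → Fin n) (ha : Function.Injective a),
      jacobianMinor f a ha = x} = ⊤) :
    Algebra.Smooth R (Quot f) := by
  rw [← RingHom.smooth_algebraMap]
  refine RingHom.Smooth.ofLocalizationSpanTarget _ _ h ?_
  rintro ⟨r, a, ha, rfl⟩
  rw [← IsScalarTower.algebraMap_eq, RingHom.smooth_algebraMap]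
  exact smooth_away f a ha _

/-- **Global Jacobian criterion, pointwise form**: if at every maximal ideal (closed point) of
`D = R[T₁, …, Tₙ]/(f₁, …, f_c)` some maximal minor `Δ_a = det (∂f_j/∂T_{a i})` of the Jacobian
does not vanish, then `D` is smooth over `R`. This is the step "the Jacobian has full rank at
every closed point of the chart, hence the chart is smooth" of every explicit chart computation
(e.g. Hu 2025, Thm. 8.5 ⟹ Thm. 8.6). [cite: GortzWedhorn2020, Def. 6.14 (p. 159)]
[cite: StacksProject, Tag 00T6] -/
theorem smooth_of_forall_isMaximal
    (h : ∀ 𝔪 : Ideal (Quot f), 𝔪.IsMaximal →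
      ∃ (a : Fin c → Fin n) (ha : Function.Injective a), jacobianMinor f a ha ∉ 𝔪) :
    Algebra.Smooth R (Quot f) :=
  smooth_of_span_jacobianMinors_eq_top f (span_jacobianMinors_eq_top_of_forall_isMaximal f h)

/-- The pointwise Jacobian criterion with the minors written as determinants in `R[T]`: if for
every maximal ideal `𝔪` of `D` there is an injective choice of columns `a` with
`det (∂f_j/∂T_{a i}) ∉ 𝔪` (read in `D`), then `D` is smooth over `R`.
[cite: GortzWedhorn2020, Def. 6.14 (p. 159)] -/
theorem smooth_of_forall_isMaximal_det
    (h : ∀ 𝔪 : Ideal (Quot f), 𝔪.IsMaximal → ∃ (a : Fin c → Fin n), Function.Injective a ∧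
      Ideal.Quotient.mk _ (Matrix.det (Matrix.of fun i j : Fin c => (f j).pderiv (a i))) ∉ 𝔪) :
    Algebra.Smooth R (Quot f) := by
  refine smooth_of_forall_isMaximal f fun 𝔪 h𝔪 => ?_
  obtain ⟨a, ha, hnot⟩ := h 𝔪 h𝔪
  exact ⟨a, ha, by rwa [jacobianMinor_eq_mk_det]⟩

/-- **Locally standard smooth of relative dimension `n - c`**: under the pointwise rank
condition, `R → D` is, locally on `Spec D` (on the cover by the `D(Δ_a)`), standard smooth of
relative dimension `n - c`. [cite: GortzWedhorn2020, Def. 6.14 (p. 159)]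
[cite: StacksProject, Tag 00T6] -/
theorem locally_isStandardSmoothOfRelativeDimension_of_forall_isMaximal
    (h : ∀ 𝔪 : Ideal (Quot f), 𝔪.IsMaximal →
      ∃ (a : Fin c → Fin n) (ha : Function.Injective a), jacobianMinor f a ha ∉ 𝔪) :
    RingHom.Locally (RingHom.IsStandardSmoothOfRelativeDimension (n - c))
      (algebraMap R (Quot f)) := by
  refine ⟨_, span_jacobianMinors_eq_top_of_forall_isMaximal f h, ?_⟩
  rintro t ⟨a, ha, rfl⟩
  rw [← IsScalarTower.algebraMap_eq, RingHom.isStandardSmoothOfRelativeDimension_algebraMap]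
  exact isStandardSmoothOfRelativeDimension_away f a ha _

/-- **Scheme form**: under the pointwise rank condition at closed points, the structure morphism
`Spec (R[T]/(f)) → Spec R` is smooth (`AlgebraicGeometry.Smooth`).
[cite: GortzWedhorn2020, Def. 6.14 (p. 159)] [cite: StacksProject, Tag 00T6] -/
theorem smooth_specMap_of_forall_isMaximal
    (h : ∀ 𝔪 : Ideal (Quot f), 𝔪.IsMaximal →
      ∃ (a : Fin c → Fin n) (ha : Function.Injective a), jacobianMinor f a ha ∉ 𝔪) :
    AlgebraicGeometry.Smooth (Spec.map (CommRingCat.ofHom (algebraMap R (Quot f)))) := by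
  rw [HasRingHomProperty.Spec_iff (P := @AlgebraicGeometry.Smooth), CommRingCat.hom_ofHom,
    RingHom.smooth_algebraMap]
  exact smooth_of_forall_isMaximal f h

/-- **Scheme form with the relative dimension**: under the pointwise rank condition at closed
points, `Spec (R[T₁, …, Tₙ]/(f₁, …, f_c)) → Spec R` is smooth of relative dimension `n - c`.
[cite: GortzWedhorn2020, Def. 6.14 (p. 159)] [cite: StacksProject, Tag 00T6] -/
theorem smoothOfRelativeDimension_specMap_of_forall_isMaximal
    (h : ∀ 𝔪 : Ideal (Quot f), 𝔪.IsMaximal →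
      ∃ (a : Fin c → Fin n) (ha : Function.Injective a), jacobianMinor f a ha ∉ 𝔪) :
    SmoothOfRelativeDimension (n - c)
      (Spec.map (CommRingCat.ofHom (algebraMap R (Quot f)))) := by
  rw [HasRingHomProperty.Spec_iff (P := @SmoothOfRelativeDimension (n - c)),
    CommRingCat.hom_ofHom]
  exact locally_isStandardSmoothOfRelativeDimension_of_forall_isMaximal f h

/-- **Span form, scheme level**: if the maximal Jacobian minors generate the unit ideal of `D`,
then `Spec D → Spec R` is smooth. [cite: StacksProject, Tag 00T6] -/
theorem smooth_specMap_of_span_jacobianMinors_eq_top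
    (h : Ideal.span {x : Quot f | ∃ (a : Fin c → Fin n) (ha : Function.Injective a),
      jacobianMinor f a ha = x} = ⊤) :
    AlgebraicGeometry.Smooth (Spec.map (CommRingCat.ofHom (algebraMap R (Quot f)))) := by
  rw [HasRingHomProperty.Spec_iff (P := @AlgebraicGeometry.Smooth), CommRingCat.hom_ofHom,
    RingHom.smooth_algebraMap]
  exact smooth_of_span_jacobianMinors_eq_top f h

/-- **Transport to an isomorphic presentation**: any `R`-algebra `A` isomorphic to
`D = R[T]/(f)` satisfying the pointwise rank condition is smooth over `R` (charts are usually
given up to an explicit `R`-algebra isomorphism). [folklore] -/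
theorem smooth_of_algEquiv_of_forall_isMaximal {A : Type*} [CommRing A] [Algebra R A]
    (e : Quot f ≃ₐ[R] A)
    (h : ∀ 𝔪 : Ideal (Quot f), 𝔪.IsMaximal →
      ∃ (a : Fin c → Fin n) (ha : Function.Injective a), jacobianMinor f a ha ∉ 𝔪) :
    Algebra.Smooth R A :=
  haveI := smooth_of_forall_isMaximal f h
  Algebra.Smooth.of_equiv e


/-! ### Arbitrary finite index types

Chart computations rarely come indexed by `Fin n` / `Fin c`; the following versions take a finite
family `F : ι → R[X_σ]` over finite index types and transport along the renaming equivalence. -/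

section General

variable {σ ι : Type*} [Fintype σ] [Fintype ι] [DecidableEq ι] (F : ι → MvPolynomial σ R)

/-- **Global Jacobian criterion for an arbitrary finite presentation**: for a finite family
`F : ι → R[X_σ]` (`σ`, `ι` finite), if at every maximal ideal of `R[X_σ]/(F)` some maximal minor
`det (∂F_j/∂X_{a i})_{i j}` (`a : ι → σ` injective) of the Jacobian is non-zero, then
`R[X_σ]/(F)` is smooth over `R`. [cite: GortzWedhorn2020, Def. 6.14 (p. 159)]
[cite: StacksProject, Tag 00T6] -/
theorem smooth_quotient_of_forall_isMaximal_det
    (h : ∀ 𝔪 : Ideal (MvPolynomial σ R ⧸ Ideal.span (Set.range F)), 𝔪.IsMaximal →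
      ∃ (a : ι → σ), Function.Injective a ∧
        Ideal.Quotient.mk _ (Matrix.det (Matrix.of fun i j : ι => (F j).pderiv (a i))) ∉ 𝔪) :
    Algebra.Smooth R (MvPolynomial σ R ⧸ Ideal.span (Set.range F)) := by
  classical
  -- transport to `Fin n`, `Fin c`
  set n := Fintype.card σ
  set c := Fintype.card ι
  let e : σ ≃ Fin n := Fintype.equivFin σ
  let e' : ι ≃ Fin c := Fintype.equivFin ι
  let Φ : MvPolynomial σ R ≃ₐ[R] MvPolynomial (Fin n) R := renameEquiv R e
  let f : Fin c → MvPolynomial (Fin n) R := fun j => Φ (F (e'.symm j))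
  have hIJ : Ideal.span (Set.range f) =
      (Ideal.span (Set.range F)).map (Φ : MvPolynomial σ R →+* MvPolynomial (Fin n) R) := by
    rw [Ideal.map_span, ← Set.range_comp]
    congr 1
    ext x
    constructor
    · rintro ⟨j, rfl⟩
      exact ⟨e'.symm j, rfl⟩
    · rintro ⟨i, rfl⟩
      exact ⟨e' i, by simp [f]⟩
  let Ψ : (MvPolynomial σ R ⧸ Ideal.span (Set.range F)) ≃ₐ[R] Quot f :=
    Ideal.quotientEquivAlg _ _ Φ hIJ
  refine @Algebra.Smooth.of_equiv R _ (Quot f) _ _ _ _ _ ?_ Ψ.symm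
  refine smooth_of_forall_isMaximal_det f fun 𝔪 h𝔪 => ?_
  -- pull the maximal ideal back along `Ψ`
  haveI hmax : (Ideal.comap Ψ 𝔪).IsMaximal := Ideal.comap_isMaximal_of_surjective Ψ Ψ.surjective
  obtain ⟨a, ha, hnot⟩ := h _ hmax
  refine ⟨e ∘ a ∘ e'.symm, e.injective.comp (ha.comp e'.symm.injective), ?_⟩
  intro hmem
  apply hnot
  rw [Ideal.mem_comap]
  -- `Ψ (mk (det M_a)) = mk (Φ (det M_a)) = mk (det of the renamed minor)`
  have hΨ : Ψ (Ideal.Quotient.mk _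
      (Matrix.det (Matrix.of fun i j : ι => (F j).pderiv (a i)))) =
      Ideal.Quotient.mk _ (Φ (Matrix.det (Matrix.of fun i j : ι => (F j).pderiv (a i)))) := rfl
  have hΦ : Φ (Matrix.det (Matrix.of fun i j : ι => (F j).pderiv (a i))) =
      Matrix.det (Matrix.of fun i j : Fin c => (f j).pderiv ((e ∘ a ∘ e'.symm) i)) := by
    rw [AlgEquiv.map_det]
    have hM : Φ.mapMatrix (Matrix.of fun i j : ι => (F j).pderiv (a i)) =
        (Matrix.of fun i j : Fin c => (f j).pderiv ((e ∘ a ∘ e'.symm) i)).submatrix e' e' :=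
      Matrix.ext fun i j => by
        simp only [AlgEquiv.mapMatrix_apply, Matrix.map_apply, Matrix.of_apply,
          Matrix.submatrix_apply, Function.comp_apply, Equiv.symm_apply_apply, f, Φ,
          MvPolynomial.renameEquiv_apply, pderiv_rename e.injective]
    rw [hM, Matrix.det_submatrix_equiv_self]
  rw [hΨ, hΦ]
  exact hmem

/-- The same for any `R`-algebra isomorphic to `R[X_σ]/(F)`. [folklore] -/
theorem smooth_of_algEquiv_quotient_of_forall_isMaximal_det {A : Type*} [CommRing A] [Algebra R A]
    (eA : (MvPolynomial σ R ⧸ Ideal.span (Set.range F)) ≃ₐ[R] A)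
    (h : ∀ 𝔪 : Ideal (MvPolynomial σ R ⧸ Ideal.span (Set.range F)), 𝔪.IsMaximal →
      ∃ (a : ι → σ), Function.Injective a ∧
        Ideal.Quotient.mk _ (Matrix.det (Matrix.of fun i j : ι => (F j).pderiv (a i))) ∉ 𝔪) :
    Algebra.Smooth R A :=
  haveI := smooth_quotient_of_forall_isMaximal_det F h
  Algebra.Smooth.of_equiv eA

end General

section GeneralScheme

/-- Scheme form of `smooth_quotient_of_forall_isMaximal_det`: `Spec (R[X_σ]/(F)) → Spec R` is
smooth. [cite: GortzWedhorn2020, Def. 6.14 (p. 159)] [cite: StacksProject, Tag 00T6] -/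
theorem smooth_specMap_quotient_of_forall_isMaximal_det {σ ι : Type u} [Fintype σ] [Fintype ι]
    [DecidableEq ι] (F : ι → MvPolynomial σ R)
    (h : ∀ 𝔪 : Ideal (MvPolynomial σ R ⧸ Ideal.span (Set.range F)), 𝔪.IsMaximal →
      ∃ (a : ι → σ), Function.Injective a ∧
        Ideal.Quotient.mk _ (Matrix.det (Matrix.of fun i j : ι => (F j).pderiv (a i))) ∉ 𝔪) :
    AlgebraicGeometry.Smooth (Spec.map (CommRingCat.ofHom
      (algebraMap R (MvPolynomial σ R ⧸ Ideal.span (Set.range F))))) := by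
  rw [HasRingHomProperty.Spec_iff (P := @AlgebraicGeometry.Smooth), CommRingCat.hom_ofHom,
    RingHom.smooth_algebraMap]
  exact smooth_quotient_of_forall_isMaximal_det F h

end GeneralScheme

end Literature.AlgebraicGeometry.Smoothening

end
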